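import Summits.BirchSwinnertonDyer.Rank1Residual.X11b.BDPRouteSelmerCountExact
import Summits.BirchSwinnertonDyer.Rank1Residual.X11b.RouteR1Coinvariants
import HarnessLib

/-!
# X11b, route R1 — atom (P6) `R1BaseSelmerCountAt` DISCHARGED: the statement of record with NO
# typed Poitou–Tate shape (`BSD(E,p)` on `R1Population` from the nine published facts, four cited
# cohomological facts, (P11) off the locally-trivial pairs, and the ONE open input)

HONEST FRAMING (cell `b2b-bsdres`, run/shared/lean/b2b/bsd-rank1-residual/, verbatim in every
file): the goal of the cell is to DELETE the COMBINATION-SHAPED residual classes of the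
Birch–Swinnerton-Dyer formula for ALL analytic-rank `≤ 1` elliptic curves over `ℚ` — "full BSD
formula for every rank `≤ 1` curve in class `C`" assembled STRICTLY from published theorems — so
that the rank-`≤ 1` remainder becomes exactly the CONSTRUCTION-SHAPED classes, which are TYPED
(missing-input `Prop`s), NOT attempted. This is not "finishing BSD". Sub-cell
`b2b-bsdres-multr1-p1` (X11b, route R1 = Castella 2018 Thm. A re-proved along the author's
erratum); a RESEARCH ROUTE; no claim beyond the stated class; X11b stays CONSTRUCTION-SHAPED;
nothing here changes a label; no named fact is minted (theorems only; no `sorry`). CONDITIONAL on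
the cited facts `poitouTate_selmerStructure_duality`, `poitouTate_sha_tateDual`,
`localEulerPoincareCharacteristic`, `fieldCdLE_two_of_numberField`, taken as hypotheses, on the
typed local shape (P11) `R1LocalKernelOrderAt` OFF the locally-trivial pairs, and on the ONE OPEN
input `R1OpenInputOnTreeAt` ((IMC)∘(BDP), PREPRINT).

## What this file does

Gen 16's statement of record `R1.bsdp_of_onTree_oneAtom_facts` (`RouteR1Coinvariants`) took ONE typed
Poitou–Tate shape at every datum: (P6) `R1BaseSelmerCountAt W p` — Jetchev–Skinner–Wan 2017
Prop. 3.2.1 with (7.1.5) on Castella's `Sel_𝔭(K, E[p^∞])`: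
`#Sel_𝔭(K, E[p^∞]) = p^a`, `a = ord_p #Ш(E/K)[p^∞] + 2((ord_p log_ω P − 1) − ord_p[E(K):ℤP]) + ord_p ∏_{w∣p} c_w`.
The sibling sub-cell multr1-p2 (gen 19, `BDPRouteSelmerCountExact.baseSelmerCountAt_of_rankOne`) has
now proved that shape at every RANK-ONE datum (`rank E(K) = 1`, `Ш(E/K)` finite as inputs; both
halves of Poitou–Tate — the `≥` half being Howard 2.1.11 `SelmerComplement` for the Kummer structure,
`BDPRouteRelaxationExact` / this sub-cell's `KummerPoitouTateExact`), modulo the two cited facts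
`poitouTate_selmerStructure_duality K` and `localEulerPoincareCharacteristic`.  This file supplies the
rank-one inputs on route R1's data WITHOUT Kolyvagin over `K` (whose tree form needs the classical
Heegner hypothesis, false for an erratum field where `q ∣ N` ramifies):

* §1 `IsErratumField.mordellWeilRank_eq_one_and_shaFinite` — `rank E(K) = 1 ∧ Ш(E/K)` finite over an
  ERRATUM FIELD from Gross–Zagier–Kolyvagin over `ℚ` applied to `E` (`ord_{s=1} L(E,s) = 1`) and to
  `E^{d_K}` (analytic rank `0` by `L(E^{d_K},1) ≠ 0` and modularity), `rank E(K) = rank E(ℚ) +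
  rank E^{d_K}(ℚ)` (`mordellWeilRank_baseChange_quadratic`) and `shaFinite_baseChange_of_shaFinite`
  (Dokchitser–Dokchitser / Milne).
* §2 **`r1BaseSelmerCountAt_of_facts`** — (P6) `R1BaseSelmerCountAt W p` for EVERY `(W, p)`, from
  `rank_eq_analyticRank_of_analyticRank_le_one`, `exists_isNewformOf` and the two cited cohomological
  facts: at an R1 datum the A′-hypotheses give `Mult p`, `Irr p`, (iv) `E(ℚ_p)[p] = 0`; the erratum
  field gives `K` imaginary quadratic with `p` split (`p ∣ N`, `p ≠ q`); §1 gives the rank-one inputs;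
  then `baseSelmerCountAt_of_rankOne`.
* §3 **`R1.bsdp_of_onTree_facts`** — THE STATEMENT OF RECORD: for every globally minimal elliptic
  `W/ℚ` and prime `p` on `R1Population` with `ord_{s=1} L(E,s) = 1`, `BSD(E,p)` follows from the NINE
  PUBLISHED named facts of `R1.bsdp` (Gross–Zagier I.7.3, GZK, Skinner 2016 Thm. C, modularity,
  Cai–Shu–Tian 1.1, Friedberg–Hoffstein (ramified form), Mazur's Manin-constant theorem, Néron
  scaling), the FOUR CITED cohomological facts (Poitou–Tate for Selmer structures, Poitou–Tate for
  `Ш`, local Euler–Poincaré characteristic, `cd_p(Γ_K) ≤ 2`), the typed LOCAL shape (P11)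
  `R1LocalKernelOrderAt` (JSW17 Prop. 3.3.4 Case 1(a) = Greenberg Lemma 3.3 bad case) ONLY off the
  locally-trivial sub-population, and the ONE OPEN input `R1OpenInputOnTreeAt` ((IMC)∘(BDP) at `𝟙`,
  PREPRINT).  EVERY Poitou–Tate atom of Cas18 Thm. 2.3 — (P6) Prop. 3.2.1, (P9) Prop. 3.3.2, (L10)
  Lemma 3.3.3 — is now a tree theorem on route R1's constructed objects.
* §4 `R1.bsdp_of_onTree_facts_of_locallyTrivial` — on the locally-trivial sub-population
  (`LocallyTrivialAt W p` for EVERY pair considered, e.g. a class on which it is a theorem) the typed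
  inputs are the four cited facts and the open input ONLY.

What stays TYPED (honest): (P11) off the locally-trivial pairs (11.7 % of ChainLocus `N < 5·10⁵`,
census3); the four cited cohomological facts and the nine published facts are hypotheses (named
facts of the tree); the open input is a PREPRINT statement. Nothing here deletes a class or changes
a label.

References: [JetchevSkinnerWan2017] Prop. 3.2.1, (7.1.5), §3.3 (arXiv:1512.06894 pp. 10–16);
[Castella2018] Thm. 2.3, §5; [Castella2018Erratum] Thm. 1.1, Thm. A′; [Howard2004HeegnerKolyvagin]
Thm. 2.1.11; [MilneADT2006] I Thm. 2.8, Thm. 4.10; [DokchitserDokchitserAnnals2010] Lemma 4.14.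
-/

noncomputable section

open scoped Classical

open WeierstrassCurve NumberField IsDedekindDomain Field
open Literature.NumberTheory.EllipticCurves Literature.NumberTheory.EllipticCurves.GreenbergSelmer
open Literature.NumberTheory.EllipticCurves.ModularForms
open Literature.NumberTheory.EllipticCurves.Rank1Residual
open Literature.NumberTheory.EllipticCurves.Rank1Residual.Typed
open Literature.NumberTheory.GaloisRepresentations
open Literature.NumberTheory.GaloisCohomology
open Summit.BirchSwinnertonDyer.Rank1Residual.X11b.AcSelmer
open Summit.BirchSwinnertonDyer.Rank1Residual.X11b.LocBridge

namespace Summit.BirchSwinnertonDyer.Rank1Residual.X11b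

/-! ## §1. Rank one and finite `Ш` over an erratum field, from GZK over `ℚ` -/

section ErratumField

variable (W : WeierstrassCurve ℚ) [W.IsElliptic]

/-- **`rank E(K) = 1` and `Ш(E/K)` finite over an ERRATUM FIELD, from GZK over `ℚ`.**  For an
elliptic `W/ℚ` with `ord_{s=1} L(E,s) = 1` and an erratum field `K` for `q` (imaginary quadratic,
`L(E^{d_K},1) ≠ 0`): Gross–Zagier–Kolyvagin over `ℚ` gives `rank E(ℚ) = 1`, `Ш(E/ℚ)` finite and
(analytic rank `0` of the twist, by modularity) `rank E^{d_K}(ℚ) = 0`, `Ш(E^{d_K}/ℚ)` finite; then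
`rank E(K) = 1 + 0` (`mordellWeilRank_baseChange_quadratic`) and `Ш(E/K)` is finite
(`shaFinite_baseChange_of_shaFinite`).  No Heegner hypothesis is used.
[cite: JetchevSkinnerWan2017, §7.4.1 (arXiv:1512.06894 p. 30)] [cite: Castella2018Erratum, Thm. A′ (p. 1)]
[cite: DokchitserDokchitserAnnals2010, Lemma 4.14 (proof)] -/
theorem IsErratumField.mordellWeilRank_eq_one_and_shaFinite
    (hGZK : rank_eq_analyticRank_of_analyticRank_le_one) (hnf : exists_isNewformOf)
    (hr : W.analyticRank = 1) {q : ℕ} {K : Type} [Field K] [NumberField K]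
    (hK : IsErratumField W K q) :
    (W.baseChange K).mordellWeilRank = 1 ∧ (W.baseChange K).ShaFinite := by
  have hmod : hasEntireLFunction_rat := hasEntireLFunction_rat_of_exists_isNewformOf hnf
  obtain ⟨h2, -⟩ := hK.1
  have hD0 : (NumberField.discr K : ℚ) ≠ 0 := by exact_mod_cast NumberField.discr_ne_zero K
  haveI hEt : (W.quadraticTwist (NumberField.discr K : ℚ)).IsElliptic :=
    W.isElliptic_quadraticTwist hD0
  have hLt : (W.quadraticTwist (NumberField.discr K : ℚ)).entireLFunction 1 ≠ 0 := hK.2.2.2.2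
  have hrt : (W.quadraticTwist (NumberField.discr K : ℚ)).analyticRank = 0 :=
    ((W.quadraticTwist _).analyticRank_eq_zero_iff_holds (hmod _)).2 hLt
  obtain ⟨hrankW, hShaW⟩ := hGZK W (le_of_eq hr)
  obtain ⟨hrankt, hShat⟩ := hGZK (W.quadraticTwist (NumberField.discr K : ℚ)) (by omega)
  refine ⟨?_, ?_⟩
  · rw [mordellWeilRank_baseChange_quadratic_holds W K h2, hrankW, hr, hrankt, hrt]
  · exact shaFinite_baseChange_of_shaFinite W K h2 hShaW hShat

end ErratumField

/-! ## §2. (P6) on route R1's data -/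

section Atom

variable (W : WeierstrassCurve ℚ) [W.IsElliptic] [W.IsGloballyMinimal] (p : ℕ) [Fact p.Prime]

/-- **Atom (P6) `R1BaseSelmerCountAt W p` — Jetchev–Skinner–Wan 2017 Prop. 3.2.1 with (7.1.5) on
Castella's `Sel_𝔭(K, E[p^∞])` at every datum of route R1 — is a THEOREM** modulo GZK over `ℚ`,
modularity and the two cited cohomological facts (Poitou–Tate for Selmer structures, Howard 2.1.11 /
Milne I 4.10(b); Tate's local Euler–Poincaré characteristic, Milne I 2.8).  At a datum: the
A′-hypotheses give `p` multiplicative, `E[p]` irreducible and (iv) `E(ℚ_p)[p] = 0`; the erratum field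
`K` is imaginary quadratic with `p` split (`p ∣ N_E`, `p ≠ q`); `rank E(K) = 1`, `Ш(E/K)` finite by
§1; the count is multr1-p2's `baseSelmerCountAt_of_rankOne` (both halves of Poitou–Tate at finite
level, passage to the limit, `p`-adic bookkeeping of the local index).
[cite: JetchevSkinnerWan2017, Prop. 3.2.1 and (7.1.5) (arXiv:1512.06894 pp. 10–11, 16)]
[cite: Castella2018, Thm. 2.3 (arXiv:1704.06608 p. 5)] [cite: Castella2018Erratum, Thm. 1.1 (iv), Thm. A′]
[cite: MilneADT2006, Ch. I, Thm. 4.10(b) and Thm. 2.8] -/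
theorem r1BaseSelmerCountAt_of_facts (hGZK : rank_eq_analyticRank_of_analyticRank_le_one)
    (hnf : exists_isNewformOf)
    (hPT : ∀ (K : Type) [Field K] [NumberField K], poitouTate_selmerStructure_duality K)
    (hEP : ∀ (K : Type) [Field K] [NumberField K] (v : HeightOneSpectrum (𝓞 K)),
      localEulerPoincareCharacteristic (v.adicCompletion K)) :
    R1BaseSelmerCountAt W p := by
  intro _ q _ K _ _ Dt H ι P hE hr hqp hmq hns hvq hK hCas hP hc hinf κ hκ γ _ 𝔭 h𝔭 he hf
  have hmult : Mult W p := hE.2.1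
  have hirr : Irr W p := hE.2.2.1
  have hiv : ∀ R : (W.baseChange ℚ_[p]).toAffine.Point, p • R = 0 → R = 0 := hE.2.2.2.2
  have hpN : p ∣ W.conductorNorm ℤ := dvd_conductorNorm_of_mult hmult
  have hsplit : SplitsIn K p := hK.2.2.1 p (Fact.out : p.Prime) hpN (Ne.symm hqp)
  obtain ⟨hrank, hSha⟩ := IsErratumField.mordellWeilRank_eq_one_and_shaFinite W hGZK hnf hr hK
  exact baseSelmerCountAt_of_rankOne W p K (hPT K) (hEP K) hmult hirr hK.1 hsplit hiv hrank hSha P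
    hinf 𝔭 h𝔭 he hf

end Atom

/-! ## §3. Statement of record: NO typed Poitou–Tate shape -/

section Record

variable (W : WeierstrassCurve ℚ) [W.IsElliptic] [W.IsGloballyMinimal] (p : ℕ) [Fact p.Prime]

/-- **Route R1 — statement of record, every Poitou–Tate atom eliminated.**  For every globally
minimal elliptic `W/ℚ` and prime `p` on `R1Population` with `ord_{s=1} L(E,s) = 1`: `BSD(E,p)`, from
the NINE PUBLISHED named facts of `R1.bsdp` (Gross–Zagier 1986 I.7.3; Gross–Zagier–Kolyvagin over
`ℚ`; Skinner 2016 Thm. C; modularity; Cai–Shu–Tian 2014 Thm. 1.1; Friedberg–Hoffstein (ramified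
form); Mazur 1978 on the Manin constant; Néron scaling), the FOUR CITED cohomological facts
(Poitou–Tate duality for Selmer structures, Howard 2.1.11 / Milne I 4.10(b); Poitou–Tate duality of
`Ш`, Harari 17.13(b) / Milne I 4.10(a); local Euler–Poincaré characteristic, Milne I 2.8;
`cd_p(Γ_K) ≤ 2`, Serre II §4.4 Prop. 13), the typed LOCAL shape (P11) `R1LocalKernelOrderAt`
(JSW17 Prop. 3.3.4 Case 1(a) = Greenberg LNM 1716 Lemma 3.3, bad case) on the pairs OFF the
locally-trivial sub-population ONLY, and the ONE OPEN input `R1OpenInputOnTreeAt` ((IMC)∘(BDP) at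
`𝟙`, PREPRINT).  The three Poitou–Tate atoms of Castella 2018 Thm. 2.3 on route R1's constructed
objects — (P6) JSW17 Prop. 3.2.1 (this file, via multr1-p2's exact count), (P9) Prop. 3.3.2 (gen 15),
(L10) Lemma 3.3.3 (gen 16) — are tree theorems modulo the cited facts.  CONDITIONAL; deletes nothing;
X11b stays CONSTRUCTION-SHAPED; no label change. [cite: Castella2018, Thm. 2.3 and §5 (arXiv:1704.06608 pp. 5, 12)]
[cite: Castella2018Erratum, Thm. 1.1, Thm. A′ (p. 1)]
[cite: JetchevSkinnerWan2017, Prop. 3.2.1, Thm. 3.3.1, Prop. 3.3.2, Lemma 3.3.3, Prop. 3.3.4 (arXiv:1512.06894 pp. 10–13)] -/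
theorem R1.bsdp_of_onTree_facts
    (hGZ : GrossZagier1986_thm_I_7_3) (hGZK : rank_eq_analyticRank_of_analyticRank_le_one)
    (hSk : Skinner2016.thmC_padicValRat_bsd_rank_zero) (hmod : exists_isNewformOf)
    (hCST : CaiShuTian2014.thm11_trivialChar)
    (hFH : friedbergHoffstein_exists_twist_ne_zero_ramifiedAt)
    (hMaz : mazur_not_dvd_maninConstant_of_odd) (hNS : integral_neronScaling_of_isGloballyMinimal)
    (hPT : ∀ (K : Type) [Field K] [NumberField K], poitouTate_selmerStructure_duality K)
    (hPT2 : ∀ (K : Type) [Field K] [NumberField K], poitouTate_sha_tateDual K)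
    (hEP : ∀ (K : Type) [Field K] [NumberField K] (v : HeightOneSpectrum (𝓞 K)),
      localEulerPoincareCharacteristic (v.adicCompletion K))
    (hcd : fieldCdLE_two_of_numberField)
    (h11 : ∀ (W : WeierstrassCurve ℚ) [W.IsElliptic] [W.IsGloballyMinimal] (p : ℕ) [Fact p.Prime],
      ¬ LocallyTrivialAt W p → R1LocalKernelOrderAt W p)
    (hA : ∀ (W : WeierstrassCurve ℚ) [W.IsElliptic] [W.IsGloballyMinimal] (p : ℕ) [Fact p.Prime],
      R1OpenInputOnTreeAt W p)
    (hW : R1Population W p) (hr : W.analyticRank = 1) : BSDp W p :=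
  R1.bsdp_of_onTree_oneAtom_facts W p hGZ hGZK hSk hmod hCST hFH hMaz hNS hPT hPT2 hEP hcd
    (fun W _ _ p _ ↦ r1BaseSelmerCountAt_of_facts W p hGZK hmod hPT hEP) h11 hA hW hr

/-- **The same on a family of pairs all of which are locally trivial** (e.g. restricted to the
sub-population where `LocallyTrivialAt` is a theorem, `locallyTrivialAt_of_not_dvd`: `p ∤ c_ℓ·N_ℓ`
for every `ℓ ∣ N_E`, `ℓ ≠ p` — 88.3 % of ChainLocus `N < 5·10⁵`): if EVERY globally minimal pair is
locally trivial — the hypothesis shape under which (P11) is never invoked — then `BSD(E,p)` on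
`R1Population`, `r_an = 1`, from the nine published facts, the four cited cohomological facts and the
ONE open input ONLY.  (Stated with the class-level hypothesis `hLT` because the record's inputs are
class-level; per-pair, (P11) is consumed only through `¬ LocallyTrivialAt W p →`.)
[cite: Castella2018, Thm. 2.3 (arXiv:1704.06608 p. 5)] [cite: GreenbergLNM1716, §3 Lemma 3.3] -/
theorem R1.bsdp_of_onTree_facts_of_locallyTrivial
    (hGZ : GrossZagier1986_thm_I_7_3) (hGZK : rank_eq_analyticRank_of_analyticRank_le_one)
    (hSk : Skinner2016.thmC_padicValRat_bsd_rank_zero) (hmod : exists_isNewformOf)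
    (hCST : CaiShuTian2014.thm11_trivialChar)
    (hFH : friedbergHoffstein_exists_twist_ne_zero_ramifiedAt)
    (hMaz : mazur_not_dvd_maninConstant_of_odd) (hNS : integral_neronScaling_of_isGloballyMinimal)
    (hPT : ∀ (K : Type) [Field K] [NumberField K], poitouTate_selmerStructure_duality K)
    (hPT2 : ∀ (K : Type) [Field K] [NumberField K], poitouTate_sha_tateDual K)
    (hEP : ∀ (K : Type) [Field K] [NumberField K] (v : HeightOneSpectrum (𝓞 K)),
      localEulerPoincareCharacteristic (v.adicCompletion K))
    (hcd : fieldCdLE_two_of_numberField)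
    (hLT : ∀ (W : WeierstrassCurve ℚ) [W.IsElliptic] [W.IsGloballyMinimal] (p : ℕ) [Fact p.Prime],
      LocallyTrivialAt W p)
    (hA : ∀ (W : WeierstrassCurve ℚ) [W.IsElliptic] [W.IsGloballyMinimal] (p : ℕ) [Fact p.Prime],
      R1OpenInputOnTreeAt W p)
    (hW : R1Population W p) (hr : W.analyticRank = 1) : BSDp W p :=
  R1.bsdp_of_onTree_facts W p hGZ hGZK hSk hmod hCST hFH hMaz hNS hPT hPT2 hEP hcd
    (fun W _ _ p _ hnot ↦ absurd (hLT W p) hnot) hA hW hr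

end Record

end Summit.BirchSwinnertonDyer.Rank1Residual.X11b

end
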